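import Summits.QuantumFields.YangMills.Theorems.BalabanUVNodesRateCarriersOfRecord11
import Summits.QuantumFields.YangMills.Theorems.BalabanUVNodesN15AtSpineCarriersBackground

/-!
# Route «BalabanUVNodes», cluster K4 «SpineRates» — node N15 = NE2 AT THE RATE-RECORD HOME `RRec₁₁ 𝔯` BY NAME (layer B
# `BalabanUVNodesRateCarriersOfRecord11`, p457330): the K4 stub `S_N15 (RRec₁₁ 𝔯)` CLOSED IN ONE APPLICATION from the three NE2⁺ layers at the
# reading's NE2 objects `(𝔯.lit F θ g₀ os).ne2 k`; the θ-sufficient form; the consumer faces; the UNIT layer by King's scalar template and the OPERATOR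
# layer with the background block LIVE, both BY NAME at the home; and the decided toys AT THE HOME — the constant reading at the LG-vector knit carriers
# has `S_N15 (RRec₁₁ 𝔯)` HYPOTHESIS-FREE (non-degenerate: inhabited index, genuine rates), the empty-index reading has it with NO estimate, the rate-less
# reading at a datum of record refutes it: the stub at the home is exactly as good as the PIN of `𝔯.lit · ne2`

Cell `pub-ymgap`, seat `pub-ymgap-dag-n15-a` (-a KNIT-BY-NAME seat of node N15; HUMAN RULING D-0062; chair R424 venue), generation 6, one file (THEOREMS ONLY,
0 `def`, 0 `sorry`).  `bears_on: R4∕N15 · K3 SpineGivenEndpointR11`.  Filed `--supports stmt-QuantumFields-19676`.  Trigger of record: this base was parked by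
generation 5 «until NODE 00's NE2 carriers of record exist» — they do since layer A `Node00/RateRecord11.lean` (p455395: `Node00.NE2Objects₁₁`,
`Node00.RateObjects₁₁.ne2 : ℕ → NE2Objects₁₁`) and layer B `BalabanUVNodesRateCarriersOfRecord11.lean` (p457330, seat dag-n22-e, dag-lead WORDS-99∕101:
`ne2OfRecord₁₁ o : NE2Carriers` field for field, `RateReading₁₁ N` (`lit : Node00.RateAssignment₁₁ N`, `ne1`), `rateCarriersOfRecord₁₁`,
`RRec₁₁ 𝔯 := fun F D g₀ os R => ∃ (h : Node00.IsDatumOfRecord₁₁C F N D) (k : ℕ), R = rateCarriersOfRecord₁₁ 𝔯 F h.params g₀ os k`, the face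
`s_N15_rRec₁₁_iff`, the transfer `forall_datumKey_of_forall_admissible`); N15 was the one K4 rate node without its `…AtRateRecord11` consumer (sibling shape
twins: dag-n16-e's `BalabanUVNodesN16AtRRec11`, dag-n18-d's `…N18AtRateRecord11`, dag-n14-d's `…N14AtRateRecord11`).  Imports layer B and dag-n15-c's
`BalabanUVNodesN15AtSpineCarriersBackground` (p456241; through it n27-a's `BalabanUVNodesN15AtSpineCarriers` p424026 — the refinement-generic closers and
guards over EVERY `RRec`, here SPECIALISED to `RRec₁₁ 𝔯` —, this seat's `BalabanUVNodesN15Knit` (p409413: `N15unit_of_covarianceTowerRate`,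
`N15unit_of_kingLeaves`, `not_N15op_rateless`, `N15_with_zero_layers_dim4`), `Literature/…/NE2NodeTorus` (p408986: the knit carriers) and the vector-piece
lineage (part 27 ∕ n15-c FILE 3: `VectorPiece.bgVecInstance₁`, `bgVecFamily₁4`, `ne2PlusOperator_vectorPiece_background₁`)).  Modifies nothing; cites by name.

THE STUB AT THE HOME.  `S_N15 (RRec₁₁ 𝔯) ↔ ∀ F D (h : IsDatumOfRecord₁₁C F N D) g₀ os k, N15At (ne2OfRecord₁₁ ((𝔯.lit F h.params g₀ os).ne2 k))`
(`s_N15_rRec₁₁_iff`), `N15At c := NE2PlusOperator c.c35 c.pi c.Kop ∧ NE2PlusSite 4 c.p c.c35 c.pi c.Ksite ∧ NE2PlusUnit c.c35 c.pi c.Kunit c.inΛ c.unitDist`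
— the three NE2⁺ layers (η-rate of the background-dependent linear theory: operator ∕ site-kernel ∕ unit-lattice, [Balaban1985BackgroundPropagators]
(3.42) p.397 ∕ Thm 3.2 (3.48) p.398 ∕ Thm 3.15 (3.187) p.432 with an η-difference; IN PRINT only the scalar `A = 0` template [King1986] Lemma 4.5 (4.38) p.674)
on the ONE family of paired instances the reading assigns to run length `k`.

CONTENT.
§1 AT THE HOME's NE2 BUNDLE `ne2OfRecord₁₁ o` — `n15At_ne2OfRecord₁₁_iff` (`Iff.rfl`), `rateCarriersOfRecord₁₁_ne2` (`rfl`), `n15At_rateCarriersOfRecord₁₁_of_ratesAt`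
(K4's per-string conclusion carries it), and the two BY-NAME producers of layers at a bundle: **`n15At_ne2OfRecord₁₁_of_covarianceTowerRate`** (UNIT layer from
King's (4.38)-shape `NE2KingTransplant.CovarianceTowerRate` package at the objects' instances — `N15Knit.N15unit_of_covarianceTowerRate`; operator and site layers
displayed) and **`n15At_ne2OfRecord₁₁_of_kingLeaves`** (the same from King's leaves (H1) `UniformCoercive` ∧ (H2) `UniformCTBound` ∧ (H2′) `UniformKernelDecay` ∧ (H3)
`EffectiveOperatorSupRate` ∧ (H4) `VolumeSum` — `N15Knit.N15unit_of_kingLeaves`, [King1986] Lemma 4.5 transplanted).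
§2 THE K4 STUB AT THE HOME — **`s_N15_rRec₁₁_of_layers`** (the three layers at every datum key, `(g₀, os)` and run length ⇒ `S_N15 (RRec₁₁ 𝔯)`: one application of
`s_N15_rRec₁₁_iff`), **`s_N15_rRec₁₁_of_forall_admissible`** ∕ `s_N15_rRec₁₁_of_layers_forall_admissible` (the θ-SUFFICIENT forms a prover of the pin discharges:
`N15At` ∕ the three layers at the reading's NE2 objects for EVERY admissible `θ : Stage11Params F N` with provisos, along every `(g₀, os, k)`; transported to the
datum keys by layer B's `forall_datumKey_of_forall_admissible` — what the K4 join at the home consumes as `h15`), the consumer faces `n15At_rRec₁₁`,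
`ne2PlusOperator_rRec₁₁`, `ne2PlusSite_rRec₁₁`, `ne2PlusUnit_rRec₁₁` (under the stub, each layer at the reading's NE2 objects of every datum key — N17's composite ∕
N19's `RatesAt` read these), and **`s_N15_rRec₁₁_of_background₁`** (THE OPERATOR LAYER WITH THE BACKGROUND BLOCK LIVE AT THE HOME: a reading whose NE2 objects at every
datum key ARE dag-n15-c's first-order background-live vector-piece carriers `⟨VecIndexS d L, c35, p, bgVecInstance₁ L hL, bgVecFamily₁4 L hL, Ksite, Kunit, inΛ,
unitDist⟩`, `0 < c35`, has the stub from the SITE and UNIT layers ALONE — `N15AtSpineCarriers.s_N15_of_background₁Reading (RRec₁₁ 𝔯)`, operator conjunct =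
`VectorPiece.ne2PlusOperator_vectorPiece_background₁`).
§3 THE PIN OF `𝔯.lit · ne2` DECIDES [decided toys at the home] — `exists_reading_ne2_const` (the reading type admits constant NE2 objects, any `o`; U3 ∕ NE3 fillers
from RR-1's `Node00.nonempty_rateObjects₁₁`, an empty dressed tower for `ne1`); `s_N15_rRec₁₁_of_emptyIndexReading` + `exists_reading_s_N15_rRec₁₁_vacuous` (A2 TRAP
AT THE HOME: a reading all of whose NE2 objects have an EMPTY index of paired instances has `S_N15 (RRec₁₁ 𝔯)` with NO estimate — n27-a's `n15At_of_isEmpty`; the pin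
must display Bałaban's run-indexed pairs, inhabited); **`s_N15_rRec₁₁_of_knitReading`** + **`exists_reading_s_N15_rRec₁₁_knit`** (NON-DEGENERATE: at every rank `N`,
every block factor `L ≥ 2`, `μ ≠ ν`, labels, `c35`, `p`, a reading whose NE2 objects at every datum key are the LG-VECTOR KNIT CARRIERS `⟨KnitIndex 3 L, c35, p,
knitInstance 3 L, knitOp166 L μ ν a b, knitSite163 L μ′ λ, covOpKernels L α β, inAll L, rhoDist L⟩` — index INHABITED (`NE2NodeTorus.knitIndex_nonempty`) — has
`S_N15 (RRec₁₁ 𝔯)` HYPOTHESIS-FREE by `N15Knit.N15_with_zero_layers_dim4`: Δ_k (1.66) at King's γ = 2 ∕ H_k (1.63) at γ = 1 ∕ C^{(k)} (2.156) at θ = L⁻¹ at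
`U ≡ 1`, and such a reading EXISTS); `not_s_N15_rRec₁₁_of_ratelessReading` + `exists_reading_not_s_N15_rRec₁₁` (a reading carrying the RATE-LESS operator family
`X_N k ≡ 2^k` on the knit carriers at the canonical parameter of SOME datum of record has `¬ S_N15 (RRec₁₁ 𝔯)` — `N15Knit.not_N15op_rateless`; given the datum
shadow of K0 `Record11Inhabited`, `∃ F D, IsDatumOfRecord₁₁C F N D`, SOME reading refutes the stub).  R422 for N15 at the home, in the kernel: `S_N15 (RRec₁₁ 𝔯)`
carries content exactly through the PIN of `𝔯.lit · ne2` — the index `I` (run-indexed pairs, inhabited), the paired instances `pi` with their background carriers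
(the size letter `M` and the (3.35)∕(3.36) window LIVE), and the three kernel families.
§4 (v1.1) COMPONENT LOCALITY — `s_N15_rRec₁₁_of_ne2_agree` ∕ `s_N15_rRec₁₁_iff_of_ne2_agree` (readings with the same `ne2` objects on the admissible tuples with provisos
have the same `S_N15` at the home: `ne1` ∕ `ne3` ∕ `u3` are idle for N15), `s_N15_rRec₁₁_of_pin` (a NAMED `ne2` pin + the ∀θ layers at the pin ⇒ the stub).

HONEST FRAMING.  Kernel bookkeeping by name; no estimate proved here; the reading `𝔯` is RESIDUAL (a skeleton quoting `S_N15 (RRec₁₁ 𝔯)` NAMES its `𝔯`); the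
hypothesis-free inhabitant is the `U ≡ 1` Landau-gauge LG-VECTOR TORUS MODEL of this lineage (backgrounds = the one-point carrier, (3.35)∕(3.36) trivial ⇒ NE2⁰
content inside NE2⁺'s type; rates ∕ decay ∕ uniformity genuine), NOT Bałaban's multiscale `G(U)`; in §2's background face only the OPERATOR layer of the LINEAR
vector single-scale piece dressed by the ABELIAN first-order species enters hypothesis-free, the SITE and UNIT layers are DISPLAYED (no producer with the
background live exists in the tree); NE2⁺ is NOT PRINTED beyond King's scalar template and NOT PROVED; `S_N15 (RRec₁₁ 𝔯)` is NOT proved for any reading of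
record; **N15 ∕ NE2 is NOT discharged** (typed 28∕28, discharged count untouched); count-neutral; one finite four-torus programme at fixed `ε` — NOT ℝ⁴, NOT
infinite volume, NOT OS, NOT a mass gap, NOT Clay.  Restate-immune (no Theses import).  No decl below carries a cite tag.
-/

set_option autoImplicit false

noncomputable section

namespace Summit.QuantumFields.YangMills.BalabanUVNodes.N15.AtRateRecord11

open Literature.MathematicalPhysics.QuantumFieldTheory.Balaban1983to89
open Literature.MathematicalPhysics.QuantumFieldTheory.Balaban1983to89.T4Continuum (T4Family ULoop)
open Literature.MathematicalPhysics.QuantumFieldTheory.Balaban1983to89.T4EtaRate (PairedInstance NE2PlusOperator NE2PlusSite NE2PlusUnit)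
open Literature.MathematicalPhysics.QuantumFieldTheory.Balaban1983to89.NE2NodeTorus (KnitIndex knitInstance knitOp knitOp166 knitSite163 covOpKernels
  inAll rhoDist)
open Node00 (IsDatumOfRecord₁₁C Stage11Params NE2Objects₁₁ RateObjects₁₁ RateAssignment₁₁ nonempty_rateObjects₁₁ datumOfRecord₁₁)
open Summit.QuantumFields.BalabanUV.T4Continuum.NE2KingTransplant (IsPseudoMetric UniformCoercive UniformCTBound UniformKernelDecay
  EffectiveOperatorSupRate VolumeSum CovarianceTowerRate)
open Summit.QuantumFields.YangMills.Theorems.BalabanUVNodesN15Knit (N15unit_of_covarianceTowerRate N15unit_of_kingLeaves not_N15op_rateless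
  N15_with_zero_layers_dim4)
open Summit.QuantumFields.YangMills.Theorems.N15AtSpineCarriers (s_N15_of_background₁Reading s_N15_of_emptyIndexReading n15At_of_isEmpty)
open Summit.QuantumFields.YangMills.BalabanUVNodes.N15.VectorPiece (VecIndexS bgVecInstance₁ bgVecFamily₁4 ne2PlusOperator_vectorPiece_background₁)
open YMDAG.UVSplit (Datum NE1pCarriers NE2Carriers RateCarriers RateRecordPred N15At RatesAt S_N15 ne2OfRecord₁₁ RateReading₁₁ rateCarriersOfRecord₁₁ RRec₁₁
  s_N15_rRec₁₁_iff forall_datumKey_of_forall_admissible)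

variable {N : ℕ} [NeZero N]

/-! ## §1 At the home's NE2 bundle `ne2OfRecord₁₁ o` -/

omit [NeZero N] in
/-- **WHAT N15 SAYS AT THE HOME's NE2 BUNDLE** (`Iff.rfl`): `N15At (ne2OfRecord₁₁ o)` IS the conjunction of the three NE2⁺ layers at RR-1's NE2 objects `o` —
the operator layer `NE2PlusOperator o.c35 o.pi o.Kop`, the site-kernel layer `NE2PlusSite 4 o.p o.c35 o.pi o.Ksite` (`d = 4`) and the unit-lattice layer
`NE2PlusUnit o.c35 o.pi o.Kunit o.inΛ o.unitDist`, all on the ONE family `o.pi`. [bookkeeping] -/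
theorem n15At_ne2OfRecord₁₁_iff (o : NE2Objects₁₁) :
    N15At (ne2OfRecord₁₁ o) ↔
      NE2PlusOperator o.c35 o.pi o.Kop ∧ NE2PlusSite 4 o.p o.c35 o.pi o.Ksite ∧ NE2PlusUnit o.c35 o.pi o.Kunit o.inΛ o.unitDist :=
  Iff.rfl

/-- The NE2 component of the bundle of record at run length `k` IS the home's NE2 bundle of the reading's level-`k` NE2 objects (`rfl`). [bookkeeping] -/
theorem rateCarriersOfRecord₁₁_ne2 (𝔯 : RateReading₁₁ N) (F : T4Family) (θ : Stage11Params F N) (g₀ : ℕ → ℝ) (os : List (ULoop F)) (k : ℕ) :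
    (rateCarriersOfRecord₁₁ 𝔯 F θ g₀ os k).ne2 = ne2OfRecord₁₁ ((𝔯.lit F θ g₀ os).ne2 k) :=
  rfl

/-- K4's per-string conclusion `RatesAt D R` at a bundle of record carries N15 at the home's NE2 bundle. [bookkeeping] -/
theorem n15At_rateCarriersOfRecord₁₁_of_ratesAt (𝔯 : RateReading₁₁ N) {F : T4Family} {D : Datum F N} (θ : Stage11Params F N) (g₀ : ℕ → ℝ)
    (os : List (ULoop F)) (k : ℕ) (h : RatesAt D (rateCarriersOfRecord₁₁ 𝔯 F θ g₀ os k)) :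
    N15At (ne2OfRecord₁₁ ((𝔯.lit F θ g₀ os).ne2 k)) :=
  h.2.1

omit [NeZero N] in
/-- **THE UNIT LAYER BY KING's (4.38)-SHAPE TOWER RATE AT A BUNDLE OF THE HOME, BY NAME.**  At RR-1's NE2 objects `o`: the operator and site layers (displayed
hypotheses — no background producer for them exists in the tree) and, for the UNIT layer, the package of `N15Knit.N15unit_of_covarianceTowerRate` — the unit
kernel of every instance `i`, at every configuration `U` in the (3.35)∧(3.36)-regular window with index-uniform `a₀`, IS the one-step η-difference of a tower of
unit-lattice effective operators `Dm i U k + Bm i U` read at embedded sites `e i`, carrying `NE2KingTransplant.CovarianceTowerRate (Dm i U) (Bm i U) (dm i) C κ′ s`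
with `0 < C`, `0 < κ′`, `0 < s < 1`, and `o.unitDist ≤ dm ∘ e` — give `N15At (ne2OfRecord₁₁ o)`.  Feed the result, per `(F, θ, g₀, os, k)`, to
`s_N15_rRec₁₁_of_forall_admissible`. [bookkeeping] -/
theorem n15At_ne2OfRecord₁₁_of_covarianceTowerRate (o : NE2Objects₁₁)
    (hop : NE2PlusOperator o.c35 o.pi o.Kop) (hsite : NE2PlusSite 4 o.p o.c35 o.pi o.Ksite)
    {a₀ : ℝ} (ha : 0 < a₀) {n : o.I → Type} [∀ i, Fintype (n i)] [∀ i, DecidableEq (n i)]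
    (e : ∀ i, (o.pi i).gc.Site → n i) (dm : ∀ i, n i → n i → ℝ)
    (Dm : ∀ i, (o.pi i).Bf.Cfg → ℕ → Matrix (n i) (n i) ℝ) (Bm : ∀ i, (o.pi i).Bf.Cfg → Matrix (n i) (n i) ℝ)
    {C κ' s : ℝ} (hC : 0 < C) (hκ' : 0 < κ') (hs0 : 0 < s) (hs1 : s < 1)
    (hdist : ∀ i y y', o.unitDist i y y' ≤ dm i (e i y) (e i y'))
    (hK : ∀ (i : o.I) (α₀ : ℝ), 0 < α₀ → (o.pi i).gf.M * α₀ ≤ a₀ → ∀ U : (o.pi i).Bf.Cfg,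
      (o.pi i).Bf.Reg335 o.c35 α₀ U → (o.pi i).Bf.Reg336 o.c35 α₀ U →
        CovarianceTowerRate (Dm i U) (Bm i U) (dm i) C κ' s ∧
        ∀ y y', (o.Kunit i).ker U y y' =
          (Dm i U ((o.pi i).gc.k + 1) + Bm i U)⁻¹ (e i y) (e i y') - (Dm i U (o.pi i).gc.k + Bm i U)⁻¹ (e i y) (e i y')) :
    N15At (ne2OfRecord₁₁ o) :=
  ⟨hop, hsite, N15unit_of_covarianceTowerRate ha e dm Dm Bm hC hκ' hs0 hs1 hdist hK⟩

omit [NeZero N] in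
/-- **THE UNIT LAYER BY KING's FOUR LEAVES AT A BUNDLE OF THE HOME, BY NAME** — as `n15At_ne2OfRecord₁₁_of_covarianceTowerRate` with the tower rate REPLACED by
King's leaves uniformly over the regular backgrounds: (H1) `UniformCoercive (Dm i U) (Bm i U) γ`, (H2) `UniformCTBound (Dm i U) (Bm i U) (dm i) κ ρ ρB`, (H2′)
`UniformKernelDecay (Dm i U) (dm i) C₁ κ`, (H3) `EffectiveOperatorSupRate (Dm i U) ε r`, (H4) `VolumeSum (dm i) κ V`, with `ρ + ρB < γ`, `0 < κ, ε, C₁, V`,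
`0 < r < 1`, pseudo-metrics `dm i` (`N15Knit.N15unit_of_kingLeaves`: the scalar template [King1986] Lemma 4.5 transplanted; (H3) is the two-spacing leaf one
layer below — at a background it is the row's open estimate). [bookkeeping] -/
theorem n15At_ne2OfRecord₁₁_of_kingLeaves (o : NE2Objects₁₁)
    (hop : NE2PlusOperator o.c35 o.pi o.Kop) (hsite : NE2PlusSite 4 o.p o.c35 o.pi o.Ksite)
    {a₀ : ℝ} (ha : 0 < a₀) {n : o.I → Type} [∀ i, Fintype (n i)] [∀ i, DecidableEq (n i)]
    (e : ∀ i, (o.pi i).gc.Site → n i) (dm : ∀ i, n i → n i → ℝ)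
    (Dm : ∀ i, (o.pi i).Bf.Cfg → ℕ → Matrix (n i) (n i) ℝ) (Bm : ∀ i, (o.pi i).Bf.Cfg → Matrix (n i) (n i) ℝ)
    {γ κ ρ ρB ε C₁ V r : ℝ} (hγ : ρ + ρB < γ) (hκ : 0 < κ) (hε : 0 < ε) (hC₁ : 0 < C₁) (hV : 0 < V)
    (hr0 : 0 < r) (hr1 : r < 1) (hd : ∀ i, IsPseudoMetric (dm i))
    (hdist : ∀ i y y', o.unitDist i y y' ≤ dm i (e i y) (e i y'))
    (hK : ∀ (i : o.I) (α₀ : ℝ), 0 < α₀ → (o.pi i).gf.M * α₀ ≤ a₀ → ∀ U : (o.pi i).Bf.Cfg,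
      (o.pi i).Bf.Reg335 o.c35 α₀ U → (o.pi i).Bf.Reg336 o.c35 α₀ U →
        UniformCoercive (Dm i U) (Bm i U) γ ∧ UniformCTBound (Dm i U) (Bm i U) (dm i) κ ρ ρB ∧
        UniformKernelDecay (Dm i U) (dm i) C₁ κ ∧ EffectiveOperatorSupRate (Dm i U) ε r ∧ VolumeSum (dm i) κ V ∧
        ∀ y y', (o.Kunit i).ker U y y' =
          (Dm i U ((o.pi i).gc.k + 1) + Bm i U)⁻¹ (e i y) (e i y') - (Dm i U (o.pi i).gc.k + Bm i U)⁻¹ (e i y) (e i y')) :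
    N15At (ne2OfRecord₁₁ o) :=
  ⟨hop, hsite, N15unit_of_kingLeaves ha e dm Dm Bm hγ hκ hε hC₁ hV hr0 hr1 hd hdist hK⟩

/-! ## §2 The K4 stub at the home -/

/-- **THE KNIT AT THE HOME OF RECORD — `S_N15 (RRec₁₁ 𝔯)` FROM THE THREE NE2⁺ LAYERS AT EVERY BUNDLE OF THE READING**: for a rate reading `𝔯`, if at every
datum of record (key `hD`, canonical parameter `hD.params`), every `(g₀, os)` and every run length `k` the NE2 objects `o := (𝔯.lit F hD.params g₀ os).ne2 k`
carry the operator, site-kernel and unit-lattice layers on their one family `o.pi`, then `S_N15 (RRec₁₁ 𝔯)` — one application of layer B's `s_N15_rRec₁₁_iff`.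
No layer is asserted here. [bookkeeping] -/
theorem s_N15_rRec₁₁_of_layers (𝔯 : RateReading₁₁ N)
    (h : ∀ (F : T4Family) (D : Datum F N) (hD : IsDatumOfRecord₁₁C F N D) (g₀ : ℕ → ℝ) (os : List (ULoop F)) (k : ℕ),
      NE2PlusOperator ((𝔯.lit F hD.params g₀ os).ne2 k).c35 ((𝔯.lit F hD.params g₀ os).ne2 k).pi ((𝔯.lit F hD.params g₀ os).ne2 k).Kop ∧
      NE2PlusSite 4 ((𝔯.lit F hD.params g₀ os).ne2 k).p ((𝔯.lit F hD.params g₀ os).ne2 k).c35 ((𝔯.lit F hD.params g₀ os).ne2 k).pi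
        ((𝔯.lit F hD.params g₀ os).ne2 k).Ksite ∧
      NE2PlusUnit ((𝔯.lit F hD.params g₀ os).ne2 k).c35 ((𝔯.lit F hD.params g₀ os).ne2 k).pi ((𝔯.lit F hD.params g₀ os).ne2 k).Kunit
        ((𝔯.lit F hD.params g₀ os).ne2 k).inΛ ((𝔯.lit F hD.params g₀ os).ne2 k).unitDist) :
    S_N15 (RRec₁₁ 𝔯) :=
  (s_N15_rRec₁₁_iff 𝔯).2 fun F D hD g₀ os k => (n15At_ne2OfRecord₁₁_iff _).2 (h F D hD g₀ os k)

/-- **THE θ-SUFFICIENT FORM OF THE KNIT** — what a prover of the pin discharges, with no canonical parameter in sight: `N15At` at the home's NE2 bundle of the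
reading for EVERY admissible `θ : Stage11Params F N` with provisos, along every `(g₀, os, k)`; layer B's `forall_datumKey_of_forall_admissible` transports it to
the datum keys.  This is the `h15` the K4 join consumes at the home. [bookkeeping] -/
theorem s_N15_rRec₁₁_of_forall_admissible (𝔯 : RateReading₁₁ N)
    (h : ∀ (F : T4Family) (θ : Stage11Params F N), θ.Provisos₁₁ → θ.Admissible → ∀ (g₀ : ℕ → ℝ) (os : List (ULoop F)) (k : ℕ),
      N15At (ne2OfRecord₁₁ ((𝔯.lit F θ g₀ os).ne2 k))) :
    S_N15 (RRec₁₁ 𝔯) :=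
  (s_N15_rRec₁₁_iff 𝔯).2
    (forall_datumKey_of_forall_admissible (P := fun F _ θ g₀ os k => N15At (ne2OfRecord₁₁ ((𝔯.lit F θ g₀ os).ne2 k)))
      fun F θ hθ hA g₀ os k => h F θ hθ hA g₀ os k)

/-- **THE θ-SUFFICIENT FORM, LAYERS SPELLED OUT**: the three NE2⁺ layers at the reading's NE2 objects for every admissible `θ` with provisos ⇒ `S_N15 (RRec₁₁ 𝔯)`.
[bookkeeping] -/
theorem s_N15_rRec₁₁_of_layers_forall_admissible (𝔯 : RateReading₁₁ N)
    (h : ∀ (F : T4Family) (θ : Stage11Params F N), θ.Provisos₁₁ → θ.Admissible → ∀ (g₀ : ℕ → ℝ) (os : List (ULoop F)) (k : ℕ),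
      NE2PlusOperator ((𝔯.lit F θ g₀ os).ne2 k).c35 ((𝔯.lit F θ g₀ os).ne2 k).pi ((𝔯.lit F θ g₀ os).ne2 k).Kop ∧
      NE2PlusSite 4 ((𝔯.lit F θ g₀ os).ne2 k).p ((𝔯.lit F θ g₀ os).ne2 k).c35 ((𝔯.lit F θ g₀ os).ne2 k).pi ((𝔯.lit F θ g₀ os).ne2 k).Ksite ∧
      NE2PlusUnit ((𝔯.lit F θ g₀ os).ne2 k).c35 ((𝔯.lit F θ g₀ os).ne2 k).pi ((𝔯.lit F θ g₀ os).ne2 k).Kunit ((𝔯.lit F θ g₀ os).ne2 k).inΛ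
        ((𝔯.lit F θ g₀ os).ne2 k).unitDist) :
    S_N15 (RRec₁₁ 𝔯) :=
  s_N15_rRec₁₁_of_forall_admissible 𝔯 fun F θ hθ hA g₀ os k => (n15At_ne2OfRecord₁₁_iff _).2 (h F θ hθ hA g₀ os k)

section Faces

variable (𝔯 : RateReading₁₁ N) (hS : S_N15 (RRec₁₁ 𝔯)) (F : T4Family) (D : Datum F N) (hD : IsDatumOfRecord₁₁C F N D) (g₀ : ℕ → ℝ)
  (os : List (ULoop F)) (k : ℕ)
include hS

/-- **WHAT THE STUB AT THE HOME DELIVERS**: N15 at the NE2 bundle of every datum key, `(g₀, os)` and run length. [bookkeeping] -/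
theorem n15At_rRec₁₁ : N15At (ne2OfRecord₁₁ ((𝔯.lit F hD.params g₀ os).ne2 k)) :=
  (s_N15_rRec₁₁_iff 𝔯).1 hS F D hD g₀ os k

/-- Consumer face: the OPERATOR layer at the reading's NE2 objects of a datum key. [bookkeeping] -/
theorem ne2PlusOperator_rRec₁₁ :
    NE2PlusOperator ((𝔯.lit F hD.params g₀ os).ne2 k).c35 ((𝔯.lit F hD.params g₀ os).ne2 k).pi ((𝔯.lit F hD.params g₀ os).ne2 k).Kop :=
  (n15At_rRec₁₁ 𝔯 hS F D hD g₀ os k).1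

/-- Consumer face: the SITE-KERNEL layer (`d = 4`) at the reading's NE2 objects of a datum key. [bookkeeping] -/
theorem ne2PlusSite_rRec₁₁ :
    NE2PlusSite 4 ((𝔯.lit F hD.params g₀ os).ne2 k).p ((𝔯.lit F hD.params g₀ os).ne2 k).c35 ((𝔯.lit F hD.params g₀ os).ne2 k).pi
      ((𝔯.lit F hD.params g₀ os).ne2 k).Ksite :=
  (n15At_rRec₁₁ 𝔯 hS F D hD g₀ os k).2.1

/-- Consumer face: the UNIT-LATTICE layer at the reading's NE2 objects of a datum key. [bookkeeping] -/
theorem ne2PlusUnit_rRec₁₁ :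
    NE2PlusUnit ((𝔯.lit F hD.params g₀ os).ne2 k).c35 ((𝔯.lit F hD.params g₀ os).ne2 k).pi ((𝔯.lit F hD.params g₀ os).ne2 k).Kunit
      ((𝔯.lit F hD.params g₀ os).ne2 k).inΛ ((𝔯.lit F hD.params g₀ os).ne2 k).unitDist :=
  (n15At_rRec₁₁ 𝔯 hS F D hD g₀ os k).2.2

end Faces

/-- **THE OPERATOR LAYER WITH THE BACKGROUND BLOCK LIVE, AT THE HOME.**  For `d + 1 ≥ 2` and `L ≥ 1`: if at every datum of record, `(g₀, os)` and run length the
reading's NE2 objects ARE dag-n15-c's FIRST-ORDER background-live vector-piece carriers — index the sized family `VecIndexS d L`, paired instances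
`VectorPiece.bgVecInstance₁ L hL` (coefficient carriers `(c′, (a′_μ)_μ)` = the (3.35) letter pair with the index's OWN `M`: guard LIVE), operator kernels the CONSTRUCTED
family `VectorPiece.bgVecFamily₁4 L hL` (all four (3.42) entries incl. the (3.44)-shaped mixed pair), any `c35 > 0`, exponent `p`, site ∕ unit kernels, region and
unit distance — together with the SITE and UNIT layers on them, then `S_N15 (RRec₁₁ 𝔯)`: the operator conjunct is the producer's theorem
`VectorPiece.ne2PlusOperator_vectorPiece_background₁` (via `N15AtSpineCarriers.s_N15_of_background₁Reading (RRec₁₁ 𝔯)`), NOT a hypothesis.  Honest scope: the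
LINEAR (`U = 1`) vector single-scale piece dressed by the ABELIAN first-order species with linearised block-average transport — NOT Bałaban's `G(U)`. [bookkeeping] -/
theorem s_N15_rRec₁₁_of_background₁ {d L : ℕ} [NeZero L] (hd : 1 ≤ d) (hL : 1 ≤ L) (𝔯 : RateReading₁₁ N)
    (h : ∀ (F : T4Family) (D : Datum F N) (hD : IsDatumOfRecord₁₁C F N D) (g₀ : ℕ → ℝ) (os : List (ULoop F)) (k : ℕ),
      ∃ (c35 p : ℝ) (Ksite Kunit : ∀ j : VecIndexS d L, B9.SiteKernel (bgVecInstance₁ (d := d) L hL j).gc (bgVecInstance₁ (d := d) L hL j).Bf)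
        (inΛ : ∀ j : VecIndexS d L, (bgVecInstance₁ (d := d) L hL j).gc.Site → Prop)
        (unitDist : ∀ j : VecIndexS d L, (bgVecInstance₁ (d := d) L hL j).gc.Site → (bgVecInstance₁ (d := d) L hL j).gc.Site → ℝ),
        0 < c35 ∧
        (𝔯.lit F hD.params g₀ os).ne2 k =
          { I := VecIndexS d L, c35 := c35, p := p, pi := bgVecInstance₁ (d := d) L hL, Kop := bgVecFamily₁4 (d := d) L hL,
            Ksite := Ksite, Kunit := Kunit, inΛ := inΛ, unitDist := unitDist } ∧
        NE2PlusSite 4 p c35 (bgVecInstance₁ (d := d) L hL) Ksite ∧ NE2PlusUnit c35 (bgVecInstance₁ (d := d) L hL) Kunit inΛ unitDist) :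
    S_N15 (RRec₁₁ 𝔯) := by
  refine s_N15_of_background₁Reading hd hL (RRec₁₁ 𝔯) ?_
  rintro F D g₀ os R ⟨hD, k, rfl⟩
  obtain ⟨c35, p, Ksite, Kunit, inΛ, unitDist, hc35, hne2, hsite, hunit⟩ := h F D hD g₀ os k
  refine ⟨c35, p, Ksite, Kunit, inΛ, unitDist, hc35, ?_, hsite, hunit⟩
  show ne2OfRecord₁₁ ((𝔯.lit F hD.params g₀ os).ne2 k) = _
  rw [hne2]
  rfl

/-! ## §3 The decided toys at the home: the pin of `𝔯.lit · ne2` decides -/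

/-- **THE READING TYPE ADMITS CONSTANT NE2 OBJECTS** (any `o`; U3 ∕ NE3 components from RR-1's `Node00.nonempty_rateObjects₁₁`, the dressed-tower component an
EMPTY tower of no content) — so every toy below is realised by SOME reading. [bookkeeping] -/
theorem exists_reading_ne2_const (o : NE2Objects₁₁) :
    ∃ 𝔯 : RateReading₁₁ N, ∀ (F : T4Family) (θ : Stage11Params F N) (g₀ : ℕ → ℝ) (os : List (ULoop F)) (k : ℕ), (𝔯.lit F θ g₀ os).ne2 k = o := by
  obtain ⟨r₀⟩ := nonempty_rateObjects₁₁ (N := N)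
  exact ⟨⟨fun _ _ _ _ => ⟨r₀.u3, r₀.ne3, fun _ => o⟩,
    fun _ _ _ _ => (⟨Empty, ⟨fun q => q.elim, fun q => q.elim, fun q => q.elim⟩, 0⟩ : NE1pCarriers)⟩, fun _ _ _ _ _ => rfl⟩

/-- **A2 TRAP AT THE HOME — A READING WITHOUT PAIRED INSTANCES HAS `S_N15 (RRec₁₁ 𝔯)` WITH NO ESTIMATE** [decided toy]: if every NE2 object of the reading (all
families, Stage-11 parameters, `(g₀, os)`, run lengths) has an EMPTY index of paired instances, the stub at the home holds vacuously (n27-a's `n15At_of_isEmpty` ∕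
`s_N15_of_emptyIndexReading` at `RRec₁₁ 𝔯`).  Reading for the PIN of `𝔯.lit · ne2`: `I` = Bałaban's run-indexed pairs of scales, INHABITED — never a free index
type. [bookkeeping] -/
theorem s_N15_rRec₁₁_of_emptyIndexReading (𝔯 : RateReading₁₁ N)
    (h : ∀ (F : T4Family) (θ : Stage11Params F N) (g₀ : ℕ → ℝ) (os : List (ULoop F)) (k : ℕ), IsEmpty ((𝔯.lit F θ g₀ os).ne2 k).I) :
    S_N15 (RRec₁₁ 𝔯) := by
  refine s_N15_of_emptyIndexReading (RRec₁₁ 𝔯) ?_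
  rintro F D g₀ os R ⟨hD, k, rfl⟩
  exact h F hD.params g₀ os k

/-- **SOME READING CLOSES THE STUB AT THE HOME WITH NO CONTENT** [decided toy]: the constant reading at NE2 objects with the EMPTY index (no paired instance, no
kernel) — the vacuous corner the pin must exclude. [bookkeeping] -/
theorem exists_reading_s_N15_rRec₁₁_vacuous :
    ∃ 𝔯 : RateReading₁₁ N,
      (∀ (F : T4Family) (θ : Stage11Params F N) (g₀ : ℕ → ℝ) (os : List (ULoop F)) (k : ℕ), IsEmpty ((𝔯.lit F θ g₀ os).ne2 k).I) ∧
      S_N15 (RRec₁₁ 𝔯) := by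
  obtain ⟨𝔯, h𝔯⟩ := exists_reading_ne2_const (N := N)
    { I := PEmpty, c35 := 0, p := 0, pi := (fun i => nomatch i), Kop := (fun i => nomatch i), Ksite := (fun i => nomatch i),
      Kunit := (fun i => nomatch i), inΛ := (fun i => nomatch i), unitDist := (fun i => nomatch i) }
  have hE : ∀ (F : T4Family) (θ : Stage11Params F N) (g₀ : ℕ → ℝ) (os : List (ULoop F)) (k : ℕ), IsEmpty ((𝔯.lit F θ g₀ os).ne2 k).I :=
    fun F θ g₀ os k => by
      rw [h𝔯 F θ g₀ os k]
      exact (inferInstance : IsEmpty PEmpty)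
  exact ⟨𝔯, hE, s_N15_rRec₁₁_of_emptyIndexReading 𝔯 hE⟩

/-- **THE LG-VECTOR KNIT READING CLOSES THE STUB AT THE HOME, HYPOTHESIS-FREE AND NON-DEGENERATE.**  For every block factor `L ≥ 2`, directions `μ ≠ ν`, labels
`a b μ′ λ α β`, letters `c35`, `p`: if at every datum of record, `(g₀, os)` and run length the reading's NE2 objects are the KNIT CARRIERS of this lineage's
`U ≡ 1` Landau-gauge vector linear theory on the four-dimensional unit tori — index `KnitIndex 3 L` (the L-divisible torus index: INHABITED,
`NE2NodeTorus.knitIndex_nonempty`), paired instances `knitInstance 3 L` (operator torus carriers, identity pairing, one-point backgrounds), operator kernels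
`knitOp166 L μ ν a b` = Δ_k (1.66), site kernels `knitSite163 L μ′ λ` = H_k (1.63), unit kernels `covOpKernels L α β` = C^{(k)} (2.156), `inAll`, `rhoDist` — then
`S_N15 (RRec₁₁ 𝔯)`, by `N15Knit.N15_with_zero_layers_dim4` (King's γ = 2 ∕ γ = 1 ∕ θ = L⁻¹; rates, decay and index-uniformity genuine; (3.35)∕(3.36) trivial on
the one-point carrier).  A MODEL-level inhabitant: NOT Bałaban's multiscale `G(U)`. [bookkeeping] -/
theorem s_N15_rRec₁₁_of_knitReading (L : ℕ) [NeZero L] (hL : 2 ≤ L) {μ ν : Fin 4} (hμν : μ ≠ ν) (a b μ' lam α β : Fin 4) (c35 p : ℝ)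
    (𝔯 : RateReading₁₁ N)
    (h : ∀ (F : T4Family) (D : Datum F N) (hD : IsDatumOfRecord₁₁C F N D) (g₀ : ℕ → ℝ) (os : List (ULoop F)) (k : ℕ),
      (𝔯.lit F hD.params g₀ os).ne2 k =
        { I := KnitIndex 3 L, c35 := c35, p := p, pi := knitInstance 3 L, Kop := knitOp166 L μ ν a b, Ksite := knitSite163 L μ' lam,
          Kunit := covOpKernels L α β, inΛ := inAll L, unitDist := rhoDist L }) :
    S_N15 (RRec₁₁ 𝔯) := by
  refine (s_N15_rRec₁₁_iff 𝔯).2 fun F D hD g₀ os k => ?_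
  rw [h F D hD g₀ os k]
  exact (N15_with_zero_layers_dim4 L hL hμν a b μ' lam α β c35 p).1

/-- **SUCH A READING EXISTS — SO SOME READING CLOSES THE STUB AT THE HOME OUTRIGHT ON AN INHABITED FAMILY WITH GENUINE RATES** [decided toy, non-degenerate]: the
constant reading at the knit carriers (any `L ≥ 2`, `μ ≠ ν`, labels, `c35`, `p`); its NE2 objects are DISPLAYED, their index is inhabited, and `S_N15 (RRec₁₁ 𝔯)`
holds with no hypothesis. [bookkeeping] -/
theorem exists_reading_s_N15_rRec₁₁_knit (L : ℕ) [NeZero L] (hL : 2 ≤ L) {μ ν : Fin 4} (hμν : μ ≠ ν) (a b μ' lam α β : Fin 4) (c35 p : ℝ) :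
    ∃ 𝔯 : RateReading₁₁ N,
      (∀ (F : T4Family) (θ : Stage11Params F N) (g₀ : ℕ → ℝ) (os : List (ULoop F)) (k : ℕ),
        (𝔯.lit F θ g₀ os).ne2 k =
          { I := KnitIndex 3 L, c35 := c35, p := p, pi := knitInstance 3 L, Kop := knitOp166 L μ ν a b, Ksite := knitSite163 L μ' lam,
            Kunit := covOpKernels L α β, inΛ := inAll L, unitDist := rhoDist L }) ∧
      (∀ (F : T4Family) (θ : Stage11Params F N) (g₀ : ℕ → ℝ) (os : List (ULoop F)) (k : ℕ), Nonempty ((𝔯.lit F θ g₀ os).ne2 k).I) ∧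
      S_N15 (RRec₁₁ 𝔯) := by
  obtain ⟨𝔯, h𝔯⟩ := exists_reading_ne2_const (N := N)
    { I := KnitIndex 3 L, c35 := c35, p := p, pi := knitInstance 3 L, Kop := knitOp166 L μ ν a b, Ksite := knitSite163 L μ' lam,
      Kunit := covOpKernels L α β, inΛ := inAll L, unitDist := rhoDist L }
  refine ⟨𝔯, h𝔯, fun F θ g₀ os k => ?_, s_N15_rRec₁₁_of_knitReading L hL hμν a b μ' lam α β c35 p 𝔯 fun F D hD g₀ os k => h𝔯 F hD.params g₀ os k⟩
  rw [h𝔯 F θ g₀ os k]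
  exact (inferInstance : Nonempty (KnitIndex 3 L))

/-- **A READING WITH THE RATE-LESS OPERATOR FAMILY AT SOME DATUM OF RECORD HAS NO `S_N15 (RRec₁₁ 𝔯)`** [decided toy]: if at the canonical parameter of some datum
of record, some `(g₀, os, k)`, the reading's NE2 objects carry, on the knit carriers `knitInstance 3 2`, the RATE-LESS operator family `X_N k ≡ 2^k` (no η-rate at
all) — whatever `c35`, the exponent and the site ∕ unit kernels —, the stub at the home FAILS (`N15Knit.not_N15op_rateless`: the operator layer would force
`2^k ≤ B₀` for all `k`).  N15's content at the home is a genuine RATE of the pinned operator family. [bookkeeping] -/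
theorem not_s_N15_rRec₁₁_of_ratelessReading (𝔯 : RateReading₁₁ N) {F : T4Family} {D : Datum F N} (hD : IsDatumOfRecord₁₁C F N D) (g₀ : ℕ → ℝ)
    (os : List (ULoop F)) (k : ℕ) (c35 p : ℝ) (μ' lam α β : Fin 4)
    (h : (𝔯.lit F hD.params g₀ os).ne2 k =
      { I := KnitIndex 3 2, c35 := c35, p := p, pi := knitInstance 3 2, Kop := knitOp 2 (fun _ _ k _ => (2 : ℝ) ^ k),
        Ksite := knitSite163 2 μ' lam, Kunit := covOpKernels 2 α β, inΛ := inAll 2, unitDist := rhoDist 2 }) :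
    ¬ S_N15 (RRec₁₁ 𝔯) := fun hS => by
  have h15 := (s_N15_rRec₁₁_iff 𝔯).1 hS F D hD g₀ os k
  rw [h] at h15
  exact not_N15op_rateless 3 c35 h15.1

/-- **GIVEN A DATUM OF RECORD, SOME READING REFUTES THE STUB AT THE HOME** [decided toy] (the hypothesis is the datum shadow of K0 `Record11Inhabited` at rank `N`):
the constant reading at the rate-less family on the knit carriers. [bookkeeping] -/
theorem exists_reading_not_s_N15_rRec₁₁ (hex : ∃ (F : T4Family) (D : Datum F N), IsDatumOfRecord₁₁C F N D) :
    ∃ 𝔯 : RateReading₁₁ N, ¬ S_N15 (RRec₁₁ 𝔯) := by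
  obtain ⟨F, D, hD⟩ := hex
  obtain ⟨𝔯, h𝔯⟩ := exists_reading_ne2_const (N := N)
    { I := KnitIndex 3 2, c35 := 0, p := 0, pi := knitInstance 3 2, Kop := knitOp 2 (fun _ _ k _ => (2 : ℝ) ^ k),
      Ksite := knitSite163 2 0 0, Kunit := covOpKernels 2 0 0, inΛ := inAll 2, unitDist := rhoDist 2 }
  exact ⟨𝔯, not_s_N15_rRec₁₁_of_ratelessReading 𝔯 hD (fun _ => 0) [] 0 0 0 0 0 0 0 (h𝔯 F hD.params (fun _ => 0) [] 0)⟩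

/-- **SUMMARY — THE STUB AT THE HOME IS DECIDED BY THE PIN** [decided toy]: some reading closes `S_N15 (RRec₁₁ ·)` on an inhabited family with genuine rates, and —
as soon as a Stage-11 datum of record exists at rank `N` — some reading refutes it.  `S_N15 (RRec₁₁ 𝔯)` is a statement ABOUT `𝔯.lit · ne2`. [bookkeeping] -/
theorem s_N15_rRec₁₁_decided_by_pin (hex : ∃ (F : T4Family) (D : Datum F N), IsDatumOfRecord₁₁C F N D) :
    (∃ 𝔯 : RateReading₁₁ N, S_N15 (RRec₁₁ 𝔯)) ∧ (∃ 𝔯 : RateReading₁₁ N, ¬ S_N15 (RRec₁₁ 𝔯)) := by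
  obtain ⟨𝔯, -, -, h𝔯⟩ := exists_reading_s_N15_rRec₁₁_knit (N := N) 2 le_rfl (show (0 : Fin 4) ≠ 1 by decide) 0 0 0 0 0 0 0 0
  exact ⟨⟨𝔯, h𝔯⟩, exists_reading_not_s_N15_rRec₁₁ hex⟩

/-! ## §4 (v1.1) Component locality: N15 at the home reads ONLY the pin of `𝔯.lit · ne2` -/

/-- **COMPONENT LOCALITY — `S_N15 (RRec₁₁ ·)` TRANSFERS ALONG READINGS WHOSE NE2 OBJECTS AGREE ON THE ADMISSIBLE TUPLES WITH PROVISOS** [bookkeeping]: if `𝔯'`'s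
level-`k` NE2 objects coincide with `𝔯`'s at every admissible Stage-11 parameter with provisos (every family, `(g₀, os)`, run length), then `S_N15 (RRec₁₁ 𝔯)` gives
`S_N15 (RRec₁₁ 𝔯')` — whatever the two readings' dressed towers `ne1`, NE3 letters `ne3` and U3 objects `u3` are.  So a definer's PIN of the `ne2` component (one pointwise
equation on admissible tuples, layer B's `rRec₁₁_congr` pattern restricted to ONE component) is ALL that `h15` at the home depends on: W1's history terms, N16's letters
and NODE O's dressed tower are idle for N15. -/
theorem s_N15_rRec₁₁_of_ne2_agree {𝔯 𝔯' : RateReading₁₁ N}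
    (h : ∀ (F : T4Family) (θ : Stage11Params F N), θ.Provisos₁₁ → θ.Admissible → ∀ (g₀ : ℕ → ℝ) (os : List (ULoop F)) (k : ℕ),
      (𝔯'.lit F θ g₀ os).ne2 k = (𝔯.lit F θ g₀ os).ne2 k)
    (hS : S_N15 (RRec₁₁ 𝔯)) : S_N15 (RRec₁₁ 𝔯') :=
  (s_N15_rRec₁₁_iff 𝔯').2 fun F D hD g₀ os k => by
    rw [h F hD.params hD.provisos hD.admissible g₀ os k]
    exact (s_N15_rRec₁₁_iff 𝔯).1 hS F D hD g₀ os k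

/-- **… hence readings with the same `ne2` pin on the admissible tuples with provisos have THE SAME `S_N15` at the home** [bookkeeping]. -/
theorem s_N15_rRec₁₁_iff_of_ne2_agree {𝔯 𝔯' : RateReading₁₁ N}
    (h : ∀ (F : T4Family) (θ : Stage11Params F N), θ.Provisos₁₁ → θ.Admissible → ∀ (g₀ : ℕ → ℝ) (os : List (ULoop F)) (k : ℕ),
      (𝔯.lit F θ g₀ os).ne2 k = (𝔯'.lit F θ g₀ os).ne2 k) :
    S_N15 (RRec₁₁ 𝔯) ↔ S_N15 (RRec₁₁ 𝔯') :=
  ⟨s_N15_rRec₁₁_of_ne2_agree fun F θ hθ hA g₀ os k => (h F θ hθ hA g₀ os k).symm,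
    s_N15_rRec₁₁_of_ne2_agree fun F θ hθ hA g₀ os k => h F θ hθ hA g₀ os k⟩

/-- **THE PIN AS ONE POINTWISE EQUATION** [bookkeeping]: if a reading's `ne2` component agrees, on the admissible tuples with provisos, with a NAMED assignment
`pin : (F : T4Family) → Stage11Params F N → (ℕ → ℝ) → List (ULoop F) → ℕ → NE2Objects₁₁` carrying the three NE2⁺ layers at every admissible tuple, then
`S_N15 (RRec₁₁ 𝔯)` — the shape in which a definer's N15 pin and an estimate seat's ∀θ-theorem about `pin` meet at the home. -/
theorem s_N15_rRec₁₁_of_pin (𝔯 : RateReading₁₁ N)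
    (pin : (F : T4Family) → Stage11Params F N → (ℕ → ℝ) → List (ULoop F) → ℕ → NE2Objects₁₁)
    (hpin : ∀ (F : T4Family) (θ : Stage11Params F N), θ.Provisos₁₁ → θ.Admissible → ∀ (g₀ : ℕ → ℝ) (os : List (ULoop F)) (k : ℕ),
      (𝔯.lit F θ g₀ os).ne2 k = pin F θ g₀ os k)
    (hest : ∀ (F : T4Family) (θ : Stage11Params F N), θ.Provisos₁₁ → θ.Admissible → ∀ (g₀ : ℕ → ℝ) (os : List (ULoop F)) (k : ℕ),
      N15At (ne2OfRecord₁₁ (pin F θ g₀ os k))) :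
    S_N15 (RRec₁₁ 𝔯) :=
  s_N15_rRec₁₁_of_forall_admissible 𝔯 fun F θ hθ hA g₀ os k => by
    rw [hpin F θ hθ hA g₀ os k]
    exact hest F θ hθ hA g₀ os k

end Summit.QuantumFields.YangMills.BalabanUVNodes.N15.AtRateRecord11

end
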